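import Summits.ABC.IUTFork.Conditional.AbcOfCor312SlackRecut
import Summits.ABC.IUTFork.Conditional.AbcOfSigmaMassDisplay
import HarnessLib

/-!
# R-H ROUND 2 EXPONENT PROGRAMME, piece F4½ (EXP-SPEC v0 §1, rh-lead g2 2026-08-27T00:54:09Z «GO rh2-q2-cond EXP-DOOR»):
# the θ-cut content door of p476943 RE-RUN WITH THE DILATED DISPLAY `DisplayWith Λ` — `Thm110LegendreWith Λ` from hypotheses cut to the content locus

PROOF-ONLY sequel (no `def`, no new `Prop`, no instance, no notation; nothing re-typed) of this seat's `Conditional/AbcOfCor312SlackRecut.lean` (gen 2,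
p476943) by abc-iut-rh2-q2-cond gen 3, composed BY NAME with abc-iut-rh2-T-1's `SigmaMass.dilatedDisplay_of_offSigmaTolerance` (p477154) / `SigmaMass.tol` and
abc-iut-rh2-xi-1's `Repair.RH.OffSigma.OffSigmaTolerance` (p469145). TAKES NO SIDE on [IUTchIII] Cor. 3.12 or on any author.

THE TWO PREDICATES OF EXP-SPEC §1 F3/F4, SPELLED OUT (their named forms `Cor22.DisplayWith` / `Cor22.Thm110LegendreWith` are abc-iut-rh2-xi-1's
`Literature/IUT/LogVolume/Corollary22With.lean`, not in the tree when this file was written; every statement below is the literal unfolding, ONE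
coefficient convention «`Λ` multiplies the WHOLE right-hand side»):
* «`DisplayWith P l η Λ`» := `1/6·log q^{∤{2,l}}(λ) ≤ Λ·((1 + 20·d_mod/l)·(log-diff + log-cond^{∤{2,l}}) + 20·(d*_mod·l + η))` — [IUTchIV] Thm. 1.10's display
  (`Cor22.Display P l η`, p. 22–23 / Cor. 2.2 (ii) proof p. 46 l. 1) with the right-hand side DILATED by `Λ ≥ 1`; `Λ = 1` IS print's display
  (`displayWith_one_iff`);
* «`Thm110LegendreWith Λ`» := `∀ η_prm (IsEtaPrm), ∀ λ ∈ UP, ∀ l ≥ 5 prime, F-core → (P2) → (P5) → (P6) → DisplayWith P l η_prm Λ` — the binders of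
  `Cor22.Thm110Legendre` EXACTLY (`thm110LegendreWith_one_iff`).

WHAT IS TYPED (`Tol(P,l) = ((l+1)/4)·5·d*_mod·l = SigmaMass.tol P l`, `d*_mod = 2^{12}·3^3·5·d_mod`, `B_III(P,l)` print's Step (v) constant, content
locus «`6·(1 + 20·d_mod/l)·(log-diff + log-cond) + 120·d*_mod·l < log q^{∤{2,l}}(λ)`» of abc-iut-C-cert-1 (p460293)):
* §0 pointwise arithmetic: `displayWith_of_display` (print's display ⟹ the dilated one for every `Λ ≥ 1`: the right-hand side is `≥ 0`),
  `displayWith_of_not_content` (OFF the content locus the dilated display is FREE for `Λ ≥ 1`, `η > 0` — abc-iut-C-cert-1's `display_of_not_content`),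
  `displayWith_one_iff`, `displayWith_inv_iff` (`Λ = 1/μ₀`: «`1/6·log q ≤ (1/μ₀)·RHS` ⟺ `1/6·(μ₀·log q) ≤ RHS`», abc-iut-rh2-T-1's currency);
* §1 THE POINTWISE DOOR (C-cert-1 machinery) `thm110LegendreWith_of_displayWith_content`: the dilated display SUPPLIED BY THE CALLER at the admissible
  `(λ, l)` ON THE CONTENT LOCUS ONLY (with `l ≠ 5` available to the caller) ⟹ «`Thm110LegendreWith Λ`»;
* §2 THE DATUM DOOR `thm110LegendreWith_of_datumDisplayWith_content_hregC`: ON THE CONTENT LOCUS the caller supplies the dilated display GIVEN a genuine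
  Θ-volume datum `T` (abc-iut-L5-t7 `ThetaPartII.stub_thetaData`) WITH its hull estimate `T.HullEstimateOf (B_III(P,l))` — which this file produces from
  [CONE-C] `hregC` (abc-iut-C-cert-1's binder VERBATIM) through p476943 §1 `hullEstimateOf_BIII_of_offRegime` (on the slot-constant regime abc-iut-S3's pinned
  junction, a theorem) ⟹ «`Thm110LegendreWith Λ`»;
* §3 THE μ-SLACK DOOR = p476943's `thm110Legendre_of_cor312Slack_content_hregC` RE-RUN WITH THE DILATED DISPLAY: `displayWith_of_cor312Slack_mu` (one datum) and
  **`thm110LegendreWith_of_cor312Slack_mu_content_hregC`** — for `0 < μ₀ ≤ 1`: [NUMΣ-C] `T.negAbsLogQ ≤ T.negLogTheta + ε P l T` (p476943 VERBATIM) ·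
  [MU-C] `OffSigmaTolerance (1 − μ₀) (SigmaMass.tol P l) T (ε P l T)` (⟺ `ε ≤ (1−μ₀)·T.gap + Tol(P,l)` ⟺ «mass(σ) ≥ μ₀·M − Tol», EXP-SPEC §0 [MU-C] shape with
  `B := ε`) · [CONE-C] `hregC` VERBATIM, all three ONLY on the content locus ⟹ «`Thm110LegendreWith (1/μ₀)`»; the upTo-currency twin
  `thm110LegendreWith_of_cor312UpTo_mu_content_hregC` ([NUMΣ-C] as «Cor. 3.12 up to `B`»: `T.negAbsLogQ − B P l T ≤ T.negLogTheta`, abc-iut-rh2-xi-1's currency);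
* §4 THE `Λ = 1` REGRESSION = the chain of record BY NAME: `thm110LegendreWith_one_iff`, `thm110Legendre_of_cor312Slack_mu_one_content_hregC`,
  **`ABC_of_cor312Slack_mu_one_content_hregC`** (`μ₀ = 1` ⟹ `Cor22.Thm110Legendre` ⟹ `ABC` through p476943 `ABC_of_cor312Slack_content_hregC`, no constant moved).
NOT TYPED HERE (said so): the end `Thm110LegendreWith Λ → GenEll_thm21_primesWith Λ → ABCWithExponent Λ` is EXP-SPEC F3/F4 + F2 + F1 (`Corollary22With.lean`,
`GenEllThm21With.lean`); the sequel `ABCExp_of_displayWith_content_hregC` is ONE λ-term over §2/§3 the minute those land. READING: a fixed `μ₀ < 1` is the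
EXPONENT currency (`1 + ε ↦ (1+ε)/μ₀` downstream, EXP-SPEC §4); `μ₀ = 1` recovers the no-loss chain. HONEST FRAMING: locates / conditionally verifies; nothing
here asserts that abc is proved or refuted, or that [IUTchIII] Cor. 3.12 / Thm. 3.11 or [IUTchIV] Thm. 1.10 holds or fails at any datum, or takes a side on any
author (Mochizuki / Scholze–Stix / Joshi / Dupuy–Hilado); `h312C` / `hMuC` / `hregC` / `hdispC` / `hdatC` are ASSUMPTION LABELS, never asserted; «the dilated
display follows from these hypotheses AS TYPED», nothing more; typed ≠ proved; instantiated ≠ endorsed; refuted-as-typed ≠ refuted-in-print. [cite: Mochizuki2012,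
IUTchIV Thm. 1.10 pp. 22–31 (display p. 22–23, Step (v) pp. 27–28, Step (viii) pp. 30–31); Prop. 1.6 p. 16; Cor. 2.2 (ii) pp. 41–48 (p. 46 l. 1)]
[cite: Mochizuki2012, IUTchIII Cor. 3.12 p. 174] [claim: Mochizuki2012, status: disputed] -/

noncomputable section

namespace Summit.ABC.IUTFork.Conditional.Cor312Slack

open Literature.IUT.LogVolume Literature.IUT.HodgeTheaters Literature.NumberTheory.DiophantineGeometry.GenEll Summit.ABC.ABC.Theorems NumberField IsDedekindDomain

variable {P : NFPoint} {l : ℕ}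

/-! ## §0 The dilated display at one point: elementary arithmetic -/

/-- The right-hand side of [IUTchIV] Thm. 1.10's display is nonnegative for `η ≥ 0` (`log-diff, log-cond ≥ 0`, `d_mod ≥ 1`). [folklore] -/
theorem displayRHS_nonneg {η : ℝ} (hη : 0 ≤ η) :
    0 ≤ (1 + 20 * (Cor22.dmod P : ℝ) / l) * (P.logDiff + Cor22.logCondAvoid P {2, l})
      + 20 * (2 ^ 12 * 3 ^ 3 * 5 * (Cor22.dmod P : ℝ) * l + η) := by
  have hLD : 0 ≤ P.logDiff := P.logDiff_nonneg
  have hLC : 0 ≤ Cor22.logCondAvoid P {2, l} := Cor22.logCondAvoid_nonneg P {2, l}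
  positivity

/-- **Print's display implies the dilated one for every `Λ ≥ 1`** (`η ≥ 0`): `Cor22.Display P l η` ⟹ «`DisplayWith P l η Λ`». [folklore]
[cite: Mochizuki2012, IUTchIV Thm. 1.10 p. 22–23] -/
theorem displayWith_of_display {η Λ : ℝ} (hη : 0 ≤ η) (hΛ : 1 ≤ Λ) (h : Cor22.Display P l η) :
    1 / 6 * Cor22.logQAvoid P {2, l} ≤
      Λ * ((1 + 20 * (Cor22.dmod P : ℝ) / l) * (P.logDiff + Cor22.logCondAvoid P {2, l})
        + 20 * (2 ^ 12 * 3 ^ 3 * 5 * (Cor22.dmod P : ℝ) * l + η)) := by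
  unfold Cor22.Display at h
  exact le_trans h (le_mul_of_one_le_left (displayRHS_nonneg hη) hΛ)

/-- **OFF the content locus the dilated display is FREE** (`Λ ≥ 1`, `η > 0`): if
`log q^{∤{2,l}}(λ) ≤ 6·(1 + 20·d_mod/l)·(log-diff + log-cond) + 120·d*_mod·l` then «`DisplayWith P l η Λ`» holds by its own additive constant —
abc-iut-C-cert-1's `display_of_not_content` then `displayWith_of_display`. No input from [IUTchIII] Cor. 3.12 in any reading.
[cite: Mochizuki2012, IUTchIV Thm. 1.10 p. 22–23; Cor. 2.2 (ii) proof p. 46] -/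
theorem displayWith_of_not_content {η Λ : ℝ} (hη : 0 < η) (hΛ : 1 ≤ Λ)
    (h : ¬ (6 * ((1 + 20 * (Cor22.dmod P : ℝ) / l) * (P.logDiff + Cor22.logCondAvoid P {2, l}))
          + 120 * (2 ^ 12 * 3 ^ 3 * 5 * (Cor22.dmod P : ℝ) * l) < Cor22.logQAvoid P {2, l})) :
    1 / 6 * Cor22.logQAvoid P {2, l} ≤
      Λ * ((1 + 20 * (Cor22.dmod P : ℝ) / l) * (P.logDiff + Cor22.logCondAvoid P {2, l})
        + 20 * (2 ^ 12 * 3 ^ 3 * 5 * (Cor22.dmod P : ℝ) * l + η)) :=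
  displayWith_of_display hη.le hΛ (display_of_not_content hη h)

/-- **`Λ = 1` IS PRINT'S DISPLAY**: «`DisplayWith P l η 1`» ⟺ `Cor22.Display P l η`. [cite: Mochizuki2012, IUTchIV Thm. 1.10 p. 22–23] -/
theorem displayWith_one_iff {η : ℝ} :
    (1 / 6 * Cor22.logQAvoid P {2, l} ≤
      1 * ((1 + 20 * (Cor22.dmod P : ℝ) / l) * (P.logDiff + Cor22.logCondAvoid P {2, l})
        + 20 * (2 ^ 12 * 3 ^ 3 * 5 * (Cor22.dmod P : ℝ) * l + η))) ↔ Cor22.Display P l η := by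
  unfold Cor22.Display
  rw [one_mul]

/-- **The two exponent currencies are one** (`μ₀ > 0`, `Λ = 1/μ₀`): «`1/6·log q ≤ (1/μ₀)·RHS`» (EXP-SPEC: `Λ` multiplies the whole right-hand side) ⟺
«`1/6·(μ₀·log q) ≤ RHS`» (abc-iut-rh2-T-1's `dilatedDisplay_of_offSigmaTolerance` with `1 − κ = μ₀`). [folklore] -/
theorem displayWith_inv_iff {μ₀ : ℝ} (hμ₀ : 0 < μ₀) {Q R : ℝ} :
    1 / 6 * Q ≤ 1 / μ₀ * R ↔ 1 / 6 * (μ₀ * Q) ≤ R := by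
  rw [one_div μ₀, ← div_eq_inv_mul, le_div_iff₀ hμ₀]
  constructor <;> intro h <;> nlinarith [h]

/-! ## §1 The pointwise door (abc-iut-C-cert-1 machinery): the dilated display supplied by the caller on the content locus only -/

/-- **«`Thm110LegendreWith Λ`» FROM THE DILATED DISPLAY ON THE CONTENT LOCUS** (`Λ ≥ 1`): if at every `η_prm`, every admissible `(λ, l)` (the binders
of `Cor22.Thm110Legendre`, with `l ≠ 5` — [IUTchIV] Thm. 1.10 p. 22, discharged here exactly as in abc-iut-S3's `ThetaPartIIDisplay.thm110Legendre_of_pointwise`: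
the `5`-torsion is rational over a theta field, `Cor22.exists_isThetaField` / `Cor22.not_condP6_five_of_isThetaField`) ON THE CONTENT LOCUS
«`6·(1 + 20·d_mod/l)·(log-diff + log-cond) + 120·d*_mod·l < log q^{∤{2,l}}(λ)`» the caller supplies «`DisplayWith P l η_prm Λ`» [hdispC — ASSUMPTION LABEL],
then «`Thm110LegendreWith Λ`»: off the locus the dilated display is free (`displayWith_of_not_content`). CONDITIONAL on `hdispC`; no side taken.
[cite: Mochizuki2012, IUTchIV Thm. 1.10 pp. 22–23; Cor. 2.2 (ii) proof p. 46 l. 1] [claim: Mochizuki2012, status: disputed] -/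
theorem thm110LegendreWith_of_displayWith_content (Λ : ℝ) (hΛ : 1 ≤ Λ)
    (hdispC : ∀ η : ℝ, IsEtaPrm η → ∀ P : NFPoint, P ∈ UP → ∀ l : ℕ, l.Prime → 5 ≤ l → l ≠ 5 →
      Cor22.AdmitsCore P → Cor22.CondP2 P l → Cor22.CondP5 P l → Cor22.CondP6 P l →
      6 * ((1 + 20 * (Cor22.dmod P : ℝ) / l) * (P.logDiff + Cor22.logCondAvoid P {2, l}))
          + 120 * (2 ^ 12 * 3 ^ 3 * 5 * (Cor22.dmod P : ℝ) * l) < Cor22.logQAvoid P {2, l} →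
      1 / 6 * Cor22.logQAvoid P {2, l} ≤
        Λ * ((1 + 20 * (Cor22.dmod P : ℝ) / l) * (P.logDiff + Cor22.logCondAvoid P {2, l})
          + 20 * (2 ^ 12 * 3 ^ 3 * 5 * (Cor22.dmod P : ℝ) * l + η))) :
    ∀ η : ℝ, IsEtaPrm η → ∀ P : NFPoint, P ∈ UP → ∀ l : ℕ, l.Prime → 5 ≤ l →
      Cor22.AdmitsCore P → Cor22.CondP2 P l → Cor22.CondP5 P l → Cor22.CondP6 P l →
      1 / 6 * Cor22.logQAvoid P {2, l} ≤
        Λ * ((1 + 20 * (Cor22.dmod P : ℝ) / l) * (P.logDiff + Cor22.logCondAvoid P {2, l})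
          + 20 * (2 ^ 12 * 3 ^ 3 * 5 * (Cor22.dmod P : ℝ) * l + η)) := by
  intro η hη P hP l hl h5 hcore hP2 hP5 hP6
  have hU : P.InU := (show P.InU ∧ P.IsMinimal from hP).1
  have hne : l ≠ 5 := by
    rintro rfl
    obtain ⟨F, hNF, hF⟩ := Cor22.exists_isThetaField P hU
    haveI := hNF
    exact Cor22.not_condP6_five_of_isThetaField hU F hF hP6
  by_cases hct : 6 * ((1 + 20 * (Cor22.dmod P : ℝ) / l) * (P.logDiff + Cor22.logCondAvoid P {2, l}))
        + 120 * (2 ^ 12 * 3 ^ 3 * 5 * (Cor22.dmod P : ℝ) * l) < Cor22.logQAvoid P {2, l}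
  · exact hdispC η hη P hP l hl h5 hne hcore hP2 hP5 hP6 hct
  · exact displayWith_of_not_content hη.1 hΛ hct -- OFF the content locus: free by its own constant — NOTHING assumed

/-! ## §2 The datum door: on the content locus the caller gets a genuine datum WITH its hull estimate (from `hregC`) -/

/-- **«`Thm110LegendreWith Λ`» FROM A DATUM-LEVEL DILATED DISPLAY ON THE CONTENT LOCUS AND `hregC`** (`Λ ≥ 1`): [hdatC — ASSUMPTION LABEL / SOCKET] at
every `η_prm`, every admissible `(λ, l)` with `l ≠ 5` ON THE CONTENT LOCUS, and every genuine Θ-volume datum `T` there CARRYING the hull estimate with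
print's constant `T.HullEstimateOf (B_III(P,l))`, the caller supplies «`DisplayWith P l η_prm Λ`» (abc-iut-rh2-T-1's F5 plugs `SigmaMass.dilatedDisplay_of_offSigmaTolerance`
here; §3 below does it for the slack currency) · [CONE-C] `hregC` = abc-iut-C-cert-1's `ABC_of_cor312C_of_hullRegimeC` binder VERBATIM ⟹ «`Thm110LegendreWith Λ`».
Pointwise (§1); on the locus a genuine datum exists (abc-iut-L5-t7 `ThetaPartII.stub_thetaData`) and p476943 §1 `hullEstimateOf_BIII_of_offRegime` gives its
hull estimate from `hregC` (slot-constant regime: abc-iut-S3's pinned junction, a theorem). CONDITIONAL on `hdatC`, `hregC`; no side taken.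
[cite: Mochizuki2012, IUTchIV Thm. 1.10 pp. 22–31 (Step (v) pp. 27–28); Cor. 2.2 (ii) proof p. 46] [claim: Mochizuki2012, status: disputed] -/
theorem thm110LegendreWith_of_datumDisplayWith_content_hregC (Λ : ℝ) (hΛ : 1 ≤ Λ)
    (hdatC : ∀ η : ℝ, IsEtaPrm η → ∀ P : NFPoint, P ∈ UP → ∀ l : ℕ, l.Prime → 5 ≤ l → l ≠ 5 →
      Cor22.AdmitsCore P → Cor22.CondP2 P l → Cor22.CondP5 P l → Cor22.CondP6 P l →
      6 * ((1 + 20 * (Cor22.dmod P : ℝ) / l) * (P.logDiff + Cor22.logCondAvoid P {2, l}))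
          + 120 * (2 ^ 12 * 3 ^ 3 * 5 * (Cor22.dmod P : ℝ) * l) < Cor22.logQAvoid P {2, l} →
      ∀ T : Cor22.ThetaVolumeDatumAt P l,
        T.HullEstimateOf
          (((l : ℝ) + 1) / 4 *
            ((1 + 12 * (Cor22.dmod P : ℝ) / l) * (P.logDiff + Cor22.logCondAvoid P {2, l})
              + 2 * Real.log l + 52
              + 20 / 3 * Real.log (((2 ^ 12 * 3 ^ 3 * 5 * Cor22.dmod P : ℕ) : ℝ) * (l : ℝ))
                * (Nat.primeCounting (2 ^ 12 * 3 ^ 3 * 5 * Cor22.dmod P * l) : ℝ))) →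
        1 / 6 * Cor22.logQAvoid P {2, l} ≤
          Λ * ((1 + 20 * (Cor22.dmod P : ℝ) / l) * (P.logDiff + Cor22.logCondAvoid P {2, l})
            + 20 * (2 ^ 12 * 3 ^ 3 * 5 * (Cor22.dmod P : ℝ) * l + η)))
    (hregC : ∀ P : NFPoint, P ∈ UP → ∀ l : ℕ, l.Prime → 5 ≤ l →
      Cor22.AdmitsCore P → Cor22.CondP2 P l → Cor22.CondP5 P l → Cor22.CondP6 P l →
      6 * ((1 + 20 * (Cor22.dmod P : ℝ) / l) * (P.logDiff + Cor22.logCondAvoid P {2, l}))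
          + 120 * (2 ^ 12 * 3 ^ 3 * 5 * (Cor22.dmod P : ℝ) * l) < Cor22.logQAvoid P {2, l} →
      ∀ T : Cor22.ThetaVolumeDatumAt P l,
        (letI := T.instFieldF; letI := T.instNumberFieldF; letI := T.instAlgebraF; letI := T.instFieldK
         letI := T.instNumberFieldK; letI := T.instAlgebraK; letI := T.instFieldFbar; letI := T.instAlgebraFbar
         letI := T.instAlgebraKFbar; letI := T.instIsElliptic
         ¬ (∀ p ∈ T.I.supportPrimes, ∀ v w : placesOver (fieldOfModuli T.E) p,
            (Summit.ABC.IUTFork.DHData.ofInput T.I).logQloc p v = (Summit.ABC.IUTFork.DHData.ofInput T.I).logQloc p w)) →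
        T.HullEstimateOf
          (((l : ℝ) + 1) / 4 *
            ((1 + 12 * (Cor22.dmod P : ℝ) / l) * (P.logDiff + Cor22.logCondAvoid P {2, l})
              + 2 * Real.log l + 52
              + 20 / 3 * Real.log (((2 ^ 12 * 3 ^ 3 * 5 * Cor22.dmod P : ℕ) : ℝ) * (l : ℝ))
                * (Nat.primeCounting (2 ^ 12 * 3 ^ 3 * 5 * Cor22.dmod P * l) : ℝ)))) :
    ∀ η : ℝ, IsEtaPrm η → ∀ P : NFPoint, P ∈ UP → ∀ l : ℕ, l.Prime → 5 ≤ l →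
      Cor22.AdmitsCore P → Cor22.CondP2 P l → Cor22.CondP5 P l → Cor22.CondP6 P l →
      1 / 6 * Cor22.logQAvoid P {2, l} ≤
        Λ * ((1 + 20 * (Cor22.dmod P : ℝ) / l) * (P.logDiff + Cor22.logCondAvoid P {2, l})
          + 20 * (2 ^ 12 * 3 ^ 3 * 5 * (Cor22.dmod P : ℝ) * l + η)) :=
  thm110LegendreWith_of_displayWith_content Λ hΛ fun η hη P hP l hl h5 hne hcore hP2 hP5 hP6 hct => by
    obtain ⟨T⟩ := ThetaPartII.stub_thetaData P hP l hl h5 hcore hP2 hP5 hP6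
    exact hdatC η hη P hP l hl h5 hne hcore hP2 hP5 hP6 hct T
      (hullEstimateOf_BIII_of_offRegime hP hl h5 hcore hP2 hP5 hP6 T (hregC P hP l hl h5 hcore hP2 hP5 hP6 hct T))

/-! ## §3 The μ-slack door: p476943's content door re-run with the dilated display -/

/-- **THE DILATED DISPLAY AT ONE DATUM FROM THE WEAKENED COROLLARY WITH A RELATIVE SLACK** (`0 < μ₀`; `l ≥ 5` prime, `l ≠ 5`, `η_prm`): at a genuine datum `T`
of `(λ, l)`, [NUMΣ] `T.negAbsLogQ ≤ T.negLogTheta + e` · [MU] `OffSigmaTolerance (1 − μ₀) (Tol(P,l)) T e` (`e ≤ (1−μ₀)·T.gap + Tol`) · the hull estimate with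
`B_III(P,l)` ⟹ «`DisplayWith P l η_prm (1/μ₀)`». abc-iut-rh2-T-1's `SigmaMass.dilatedDisplay_of_offSigmaTolerance` (`κ = 1 − μ₀`) in the `Λ = 1/μ₀` currency
(`displayWith_inv_iff`). CONDITIONAL bookkeeping; no side taken. [cite: Mochizuki2012, IUTchIV Thm. 1.10 Steps (viii)–(x) pp. 30–32] [claim: Mochizuki2012, status: disputed] -/
theorem displayWith_of_cor312Slack_mu {μ₀ : ℝ} (hμ₀ : 0 < μ₀) (hl : l.Prime) (h5 : 5 ≤ l) (hne : l ≠ 5) {η : ℝ} (hη : IsEtaPrm η)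
    (T : Cor22.ThetaVolumeDatumAt P l) (hU : P.InU) {e : ℝ} (h312 : T.negAbsLogQ ≤ T.negLogTheta + e)
    (hmu : Repair.RH.OffSigma.OffSigmaTolerance (1 - μ₀) (SigmaMass.tol P l) T e)
    (h2 : T.HullEstimateOf
      (((l : ℝ) + 1) / 4 *
        ((1 + 12 * (Cor22.dmod P : ℝ) / l) * (P.logDiff + Cor22.logCondAvoid P {2, l})
          + 2 * Real.log l + 52
          + 20 / 3 * Real.log (((2 ^ 12 * 3 ^ 3 * 5 * Cor22.dmod P : ℕ) : ℝ) * (l : ℝ))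
            * (Nat.primeCounting (2 ^ 12 * 3 ^ 3 * 5 * Cor22.dmod P * l) : ℝ)))) :
    1 / 6 * Cor22.logQAvoid P {2, l} ≤
      1 / μ₀ * ((1 + 20 * (Cor22.dmod P : ℝ) / l) * (P.logDiff + Cor22.logCondAvoid P {2, l})
        + 20 * (2 ^ 12 * 3 ^ 3 * 5 * (Cor22.dmod P : ℝ) * l + η)) := by
  have h1 : T.negAbsLogQ - e ≤ T.negLogTheta := by linarith
  have h := SigmaMass.dilatedDisplay_of_offSigmaTolerance hl h5 hne hη T hU hmu h1 h2
  rw [sub_sub_cancel] at h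
  exact (displayWith_inv_iff hμ₀).2 h

/-- **F4½ — «`Thm110LegendreWith (1/μ₀)`» FROM THE WEAKENED COROLLARY WITH A RELATIVE SLACK, θ-CUT** (`0 < μ₀ ≤ 1`) = p476943's
`thm110Legendre_of_cor312Slack_content_hregC` RE-RUN WITH THE DILATED DISPLAY: [NUMΣ-C] `T.negAbsLogQ ≤ T.negLogTheta + ε P l T` at every genuine Θ-volume
datum of every admissible `(λ, l)` ON THE CONTENT LOCUS (p476943's binder VERBATIM; `ε` = the off-Σ remainder an `S_H|Σ`-certificate leaves) · [MU-C]
`OffSigmaTolerance (1 − μ₀) (SigmaMass.tol P l) T (ε P l T)` there — `ε ≤ (1−μ₀)·T.gap + Tol(P,l)`, i.e. «retained Σ-mass ≥ μ₀·M − Tol» (EXP-SPEC §0 [MU-C],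
abc-iut-rh2-xi-1's predicate with `B := ε P l T`; `M = T.gap` is abc-iut-rh2-w-1's `totalTrivialMass_chosen_eq_gap`) · [CONE-C] `hregC` VERBATIM ⟹
«`Thm110LegendreWith (1/μ₀)`». §2 with the socket filled by `displayWith_of_cor312Slack_mu`. At every admissible `(λ, l)` OFF the content locus NOTHING is
assumed. `μ₀ = 1`: §4 (the chain of record). CONDITIONAL; nothing is asserted about the hypotheses; no side taken.
[cite: Mochizuki2012, IUTchIV Thm. 1.10 pp. 22–31; Cor. 2.2 (ii) proof p. 46] [cite: Mochizuki2012, IUTchIII Cor. 3.12 p. 174] [claim: Mochizuki2012, status: disputed] -/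
theorem thm110LegendreWith_of_cor312Slack_mu_content_hregC (μ₀ : ℝ) (hμ₀ : 0 < μ₀) (hμ₁ : μ₀ ≤ 1)
    (ε : ∀ (P : NFPoint) (l : ℕ), Cor22.ThetaVolumeDatumAt P l → ℝ)
    -- [NUMΣ-C] the weakened number-level Corollary with slack `ε`, demanded ONLY on the content locus (p476943 VERBATIM)
    (h312C : ∀ P : NFPoint, P ∈ UP → ∀ l : ℕ, l.Prime → 5 ≤ l →
      Cor22.AdmitsCore P → Cor22.CondP2 P l → Cor22.CondP5 P l → Cor22.CondP6 P l →
      6 * ((1 + 20 * (Cor22.dmod P : ℝ) / l) * (P.logDiff + Cor22.logCondAvoid P {2, l}))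
          + 120 * (2 ^ 12 * 3 ^ 3 * 5 * (Cor22.dmod P : ℝ) * l) < Cor22.logQAvoid P {2, l} →
      ∀ T : Cor22.ThetaVolumeDatumAt P l, T.negAbsLogQ ≤ T.negLogTheta + ε P l T)
    -- [MU-C] the slack is within the RELATIVE tolerance `(1 − μ₀)·T.gap + Tol(P,l)`, demanded ONLY there
    (hMuC : ∀ P : NFPoint, P ∈ UP → ∀ l : ℕ, l.Prime → 5 ≤ l →
      Cor22.AdmitsCore P → Cor22.CondP2 P l → Cor22.CondP5 P l → Cor22.CondP6 P l →
      6 * ((1 + 20 * (Cor22.dmod P : ℝ) / l) * (P.logDiff + Cor22.logCondAvoid P {2, l}))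
          + 120 * (2 ^ 12 * 3 ^ 3 * 5 * (Cor22.dmod P : ℝ) * l) < Cor22.logQAvoid P {2, l} →
      ∀ T : Cor22.ThetaVolumeDatumAt P l, Repair.RH.OffSigma.OffSigmaTolerance (1 - μ₀) (SigmaMass.tol P l) T (ε P l T))
    -- [CONE-C] abc-iut-C-cert-1's `hregC` VERBATIM
    (hregC : ∀ P : NFPoint, P ∈ UP → ∀ l : ℕ, l.Prime → 5 ≤ l →
      Cor22.AdmitsCore P → Cor22.CondP2 P l → Cor22.CondP5 P l → Cor22.CondP6 P l →
      6 * ((1 + 20 * (Cor22.dmod P : ℝ) / l) * (P.logDiff + Cor22.logCondAvoid P {2, l}))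
          + 120 * (2 ^ 12 * 3 ^ 3 * 5 * (Cor22.dmod P : ℝ) * l) < Cor22.logQAvoid P {2, l} →
      ∀ T : Cor22.ThetaVolumeDatumAt P l,
        (letI := T.instFieldF; letI := T.instNumberFieldF; letI := T.instAlgebraF; letI := T.instFieldK
         letI := T.instNumberFieldK; letI := T.instAlgebraK; letI := T.instFieldFbar; letI := T.instAlgebraFbar
         letI := T.instAlgebraKFbar; letI := T.instIsElliptic
         ¬ (∀ p ∈ T.I.supportPrimes, ∀ v w : placesOver (fieldOfModuli T.E) p,
            (Summit.ABC.IUTFork.DHData.ofInput T.I).logQloc p v = (Summit.ABC.IUTFork.DHData.ofInput T.I).logQloc p w)) →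
        T.HullEstimateOf
          (((l : ℝ) + 1) / 4 *
            ((1 + 12 * (Cor22.dmod P : ℝ) / l) * (P.logDiff + Cor22.logCondAvoid P {2, l})
              + 2 * Real.log l + 52
              + 20 / 3 * Real.log (((2 ^ 12 * 3 ^ 3 * 5 * Cor22.dmod P : ℕ) : ℝ) * (l : ℝ))
                * (Nat.primeCounting (2 ^ 12 * 3 ^ 3 * 5 * Cor22.dmod P * l) : ℝ)))) :
    ∀ η : ℝ, IsEtaPrm η → ∀ P : NFPoint, P ∈ UP → ∀ l : ℕ, l.Prime → 5 ≤ l →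
      Cor22.AdmitsCore P → Cor22.CondP2 P l → Cor22.CondP5 P l → Cor22.CondP6 P l →
      1 / 6 * Cor22.logQAvoid P {2, l} ≤
        1 / μ₀ * ((1 + 20 * (Cor22.dmod P : ℝ) / l) * (P.logDiff + Cor22.logCondAvoid P {2, l})
          + 20 * (2 ^ 12 * 3 ^ 3 * 5 * (Cor22.dmod P : ℝ) * l + η)) :=
  thm110LegendreWith_of_datumDisplayWith_content_hregC (1 / μ₀) (by rw [le_div_iff₀ hμ₀, one_mul]; exact hμ₁)
    (fun _ hη P hP l hl h5 hne hcore hP2 hP5 hP6 hct T h2 =>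
      displayWith_of_cor312Slack_mu hμ₀ hl h5 hne hη T hP.1 (h312C P hP l hl h5 hcore hP2 hP5 hP6 hct T)
        (hMuC P hP l hl h5 hcore hP2 hP5 hP6 hct T) h2)
    hregC

/-- **The same door in the «Cor. 3.12 up to `B`» currency** (abc-iut-rh2-xi-1 / rh2-T-1: `T.negAbsLogQ − B ≤ T.negLogTheta`, `B = B_triv(σᶜ)` the off-Σ bound;
EXP-SPEC §0 [MU-C] `OffSigmaTolerance (1−μ₀) (SigmaMass.tol P l) T B` VERBATIM): [UPTO-C] · [MU-C] · [CONE-C] on the content locus ⟹ «`Thm110LegendreWith (1/μ₀)`».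
A λ-term over `thm110LegendreWith_of_cor312Slack_mu_content_hregC` with `ε := B`. CONDITIONAL; no side taken.
[cite: Mochizuki2012, IUTchIV Thm. 1.10 pp. 22–31; Cor. 2.2 (ii) proof p. 46] [cite: Mochizuki2012, IUTchIII Cor. 3.12 p. 174] [claim: Mochizuki2012, status: disputed] -/
theorem thm110LegendreWith_of_cor312UpTo_mu_content_hregC (μ₀ : ℝ) (hμ₀ : 0 < μ₀) (hμ₁ : μ₀ ≤ 1)
    (B : ∀ (P : NFPoint) (l : ℕ), Cor22.ThetaVolumeDatumAt P l → ℝ)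
    -- [UPTO-C] «Cor. 3.12 up to `B`» at the genuine data, ONLY on the content locus
    (hUpToC : ∀ P : NFPoint, P ∈ UP → ∀ l : ℕ, l.Prime → 5 ≤ l →
      Cor22.AdmitsCore P → Cor22.CondP2 P l → Cor22.CondP5 P l → Cor22.CondP6 P l →
      6 * ((1 + 20 * (Cor22.dmod P : ℝ) / l) * (P.logDiff + Cor22.logCondAvoid P {2, l}))
          + 120 * (2 ^ 12 * 3 ^ 3 * 5 * (Cor22.dmod P : ℝ) * l) < Cor22.logQAvoid P {2, l} →
      ∀ T : Cor22.ThetaVolumeDatumAt P l, T.negAbsLogQ - B P l T ≤ T.negLogTheta)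
    -- [MU-C] `B ≤ (1 − μ₀)·T.gap + Tol(P,l)`, ONLY there
    (hMuC : ∀ P : NFPoint, P ∈ UP → ∀ l : ℕ, l.Prime → 5 ≤ l →
      Cor22.AdmitsCore P → Cor22.CondP2 P l → Cor22.CondP5 P l → Cor22.CondP6 P l →
      6 * ((1 + 20 * (Cor22.dmod P : ℝ) / l) * (P.logDiff + Cor22.logCondAvoid P {2, l}))
          + 120 * (2 ^ 12 * 3 ^ 3 * 5 * (Cor22.dmod P : ℝ) * l) < Cor22.logQAvoid P {2, l} →
      ∀ T : Cor22.ThetaVolumeDatumAt P l, Repair.RH.OffSigma.OffSigmaTolerance (1 - μ₀) (SigmaMass.tol P l) T (B P l T))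
    -- [CONE-C] abc-iut-C-cert-1's `hregC` VERBATIM
    (hregC : ∀ P : NFPoint, P ∈ UP → ∀ l : ℕ, l.Prime → 5 ≤ l →
      Cor22.AdmitsCore P → Cor22.CondP2 P l → Cor22.CondP5 P l → Cor22.CondP6 P l →
      6 * ((1 + 20 * (Cor22.dmod P : ℝ) / l) * (P.logDiff + Cor22.logCondAvoid P {2, l}))
          + 120 * (2 ^ 12 * 3 ^ 3 * 5 * (Cor22.dmod P : ℝ) * l) < Cor22.logQAvoid P {2, l} →
      ∀ T : Cor22.ThetaVolumeDatumAt P l,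
        (letI := T.instFieldF; letI := T.instNumberFieldF; letI := T.instAlgebraF; letI := T.instFieldK
         letI := T.instNumberFieldK; letI := T.instAlgebraK; letI := T.instFieldFbar; letI := T.instAlgebraFbar
         letI := T.instAlgebraKFbar; letI := T.instIsElliptic
         ¬ (∀ p ∈ T.I.supportPrimes, ∀ v w : placesOver (fieldOfModuli T.E) p,
            (Summit.ABC.IUTFork.DHData.ofInput T.I).logQloc p v = (Summit.ABC.IUTFork.DHData.ofInput T.I).logQloc p w)) →
        T.HullEstimateOf
          (((l : ℝ) + 1) / 4 *
            ((1 + 12 * (Cor22.dmod P : ℝ) / l) * (P.logDiff + Cor22.logCondAvoid P {2, l})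
              + 2 * Real.log l + 52
              + 20 / 3 * Real.log (((2 ^ 12 * 3 ^ 3 * 5 * Cor22.dmod P : ℕ) : ℝ) * (l : ℝ))
                * (Nat.primeCounting (2 ^ 12 * 3 ^ 3 * 5 * Cor22.dmod P * l) : ℝ)))) :
    ∀ η : ℝ, IsEtaPrm η → ∀ P : NFPoint, P ∈ UP → ∀ l : ℕ, l.Prime → 5 ≤ l →
      Cor22.AdmitsCore P → Cor22.CondP2 P l → Cor22.CondP5 P l → Cor22.CondP6 P l →
      1 / 6 * Cor22.logQAvoid P {2, l} ≤
        1 / μ₀ * ((1 + 20 * (Cor22.dmod P : ℝ) / l) * (P.logDiff + Cor22.logCondAvoid P {2, l})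
          + 20 * (2 ^ 12 * 3 ^ 3 * 5 * (Cor22.dmod P : ℝ) * l + η)) :=
  thm110LegendreWith_of_cor312Slack_mu_content_hregC μ₀ hμ₀ hμ₁ B
    (fun P hP l hl h5 hcore hP2 hP5 hP6 hct T => by
      have h := hUpToC P hP l hl h5 hcore hP2 hP5 hP6 hct T
      linarith)
    hMuC hregC

/-! ## §4 The `Λ = 1` regression: `μ₀ = 1` IS the chain of record, by name -/

/-- **«`Thm110LegendreWith 1`» ⟺ `Cor22.Thm110Legendre`** (binders identical; `displayWith_one_iff` pointwise). [cite: Mochizuki2012, IUTchIV Cor. 2.2 (ii) p. 46 l. 1]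
[claim: Mochizuki2012, status: disputed] -/
theorem thm110LegendreWith_one_iff :
    (∀ η : ℝ, IsEtaPrm η → ∀ P : NFPoint, P ∈ UP → ∀ l : ℕ, l.Prime → 5 ≤ l →
      Cor22.AdmitsCore P → Cor22.CondP2 P l → Cor22.CondP5 P l → Cor22.CondP6 P l →
      1 / 6 * Cor22.logQAvoid P {2, l} ≤
        1 * ((1 + 20 * (Cor22.dmod P : ℝ) / l) * (P.logDiff + Cor22.logCondAvoid P {2, l})
          + 20 * (2 ^ 12 * 3 ^ 3 * 5 * (Cor22.dmod P : ℝ) * l + η))) ↔ Cor22.Thm110Legendre := by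
  unfold Cor22.Thm110Legendre
  simp only [displayWith_one_iff]

/-- **`μ₀ = 1` regression at the `Thm110Legendre` level**: the μ-slack door at `μ₀ = 1` yields `Cor22.Thm110Legendre` with print's constants — and its [MU-C]
binder `OffSigmaTolerance (1 − 1) Tol T ε` is p476943's [TOL-C] `ε ≤ Tol(P,l)` (`(1−1)·T.gap = 0`). CONDITIONAL; no side taken.
[cite: Mochizuki2012, IUTchIV Thm. 1.10 pp. 22–31] [cite: Mochizuki2012, IUTchIII Cor. 3.12 p. 174] [claim: Mochizuki2012, status: disputed] -/
theorem thm110Legendre_of_cor312Slack_mu_one_content_hregC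
    (ε : ∀ (P : NFPoint) (l : ℕ), Cor22.ThetaVolumeDatumAt P l → ℝ)
    (h312C : ∀ P : NFPoint, P ∈ UP → ∀ l : ℕ, l.Prime → 5 ≤ l →
      Cor22.AdmitsCore P → Cor22.CondP2 P l → Cor22.CondP5 P l → Cor22.CondP6 P l →
      6 * ((1 + 20 * (Cor22.dmod P : ℝ) / l) * (P.logDiff + Cor22.logCondAvoid P {2, l}))
          + 120 * (2 ^ 12 * 3 ^ 3 * 5 * (Cor22.dmod P : ℝ) * l) < Cor22.logQAvoid P {2, l} →
      ∀ T : Cor22.ThetaVolumeDatumAt P l, T.negAbsLogQ ≤ T.negLogTheta + ε P l T)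
    (hMuC : ∀ P : NFPoint, P ∈ UP → ∀ l : ℕ, l.Prime → 5 ≤ l →
      Cor22.AdmitsCore P → Cor22.CondP2 P l → Cor22.CondP5 P l → Cor22.CondP6 P l →
      6 * ((1 + 20 * (Cor22.dmod P : ℝ) / l) * (P.logDiff + Cor22.logCondAvoid P {2, l}))
          + 120 * (2 ^ 12 * 3 ^ 3 * 5 * (Cor22.dmod P : ℝ) * l) < Cor22.logQAvoid P {2, l} →
      ∀ T : Cor22.ThetaVolumeDatumAt P l, Repair.RH.OffSigma.OffSigmaTolerance (1 - 1) (SigmaMass.tol P l) T (ε P l T))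
    (hregC : ∀ P : NFPoint, P ∈ UP → ∀ l : ℕ, l.Prime → 5 ≤ l →
      Cor22.AdmitsCore P → Cor22.CondP2 P l → Cor22.CondP5 P l → Cor22.CondP6 P l →
      6 * ((1 + 20 * (Cor22.dmod P : ℝ) / l) * (P.logDiff + Cor22.logCondAvoid P {2, l}))
          + 120 * (2 ^ 12 * 3 ^ 3 * 5 * (Cor22.dmod P : ℝ) * l) < Cor22.logQAvoid P {2, l} →
      ∀ T : Cor22.ThetaVolumeDatumAt P l,
        (letI := T.instFieldF; letI := T.instNumberFieldF; letI := T.instAlgebraF; letI := T.instFieldK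
         letI := T.instNumberFieldK; letI := T.instAlgebraK; letI := T.instFieldFbar; letI := T.instAlgebraFbar
         letI := T.instAlgebraKFbar; letI := T.instIsElliptic
         ¬ (∀ p ∈ T.I.supportPrimes, ∀ v w : placesOver (fieldOfModuli T.E) p,
            (Summit.ABC.IUTFork.DHData.ofInput T.I).logQloc p v = (Summit.ABC.IUTFork.DHData.ofInput T.I).logQloc p w)) →
        T.HullEstimateOf
          (((l : ℝ) + 1) / 4 *
            ((1 + 12 * (Cor22.dmod P : ℝ) / l) * (P.logDiff + Cor22.logCondAvoid P {2, l})
              + 2 * Real.log l + 52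
              + 20 / 3 * Real.log (((2 ^ 12 * 3 ^ 3 * 5 * Cor22.dmod P : ℕ) : ℝ) * (l : ℝ))
                * (Nat.primeCounting (2 ^ 12 * 3 ^ 3 * 5 * Cor22.dmod P * l) : ℝ)))) :
    Cor22.Thm110Legendre :=
  thm110LegendreWith_one_iff.1 (by
    have h := thm110LegendreWith_of_cor312Slack_mu_content_hregC 1 one_pos le_rfl ε h312C hMuC hregC
    simpa only [div_one] using h)

/-- **`μ₀ = 1` regression at the `ABC` level = p476943 BY NAME**: the [MU-C] binder at `μ₀ = 1`, `OffSigmaTolerance (1 − 1) (Tol(P,l)) T (ε P l T)`, IS p476943's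
[TOL-C] `ε P l T ≤ ((l+1)/4)·5·d*_mod·l` (`(1−1)·T.gap = 0`, `SigmaMass.tol` unfolds to that tolerance), so [NUMΣ-C] · [MU-C]₁ · [CONE-C] ⟹ `ABC` through
`ABC_of_cor312Slack_content_hregC` with NO constant of the chain of record changed. CONDITIONAL; nothing is asserted about the hypotheses; no side taken.
[cite: Mochizuki2012, IUTchIV Cor. 2.2–2.3 pp. 41–55] [cite: Mochizuki2012, IUTchIII Cor. 3.12 p. 174] [claim: Mochizuki2012, status: disputed] -/
theorem ABC_of_cor312Slack_mu_one_content_hregC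
    (ε : ∀ (P : NFPoint) (l : ℕ), Cor22.ThetaVolumeDatumAt P l → ℝ)
    (h312C : ∀ P : NFPoint, P ∈ UP → ∀ l : ℕ, l.Prime → 5 ≤ l →
      Cor22.AdmitsCore P → Cor22.CondP2 P l → Cor22.CondP5 P l → Cor22.CondP6 P l →
      6 * ((1 + 20 * (Cor22.dmod P : ℝ) / l) * (P.logDiff + Cor22.logCondAvoid P {2, l}))
          + 120 * (2 ^ 12 * 3 ^ 3 * 5 * (Cor22.dmod P : ℝ) * l) < Cor22.logQAvoid P {2, l} →
      ∀ T : Cor22.ThetaVolumeDatumAt P l, T.negAbsLogQ ≤ T.negLogTheta + ε P l T)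
    (hMuC : ∀ P : NFPoint, P ∈ UP → ∀ l : ℕ, l.Prime → 5 ≤ l →
      Cor22.AdmitsCore P → Cor22.CondP2 P l → Cor22.CondP5 P l → Cor22.CondP6 P l →
      6 * ((1 + 20 * (Cor22.dmod P : ℝ) / l) * (P.logDiff + Cor22.logCondAvoid P {2, l}))
          + 120 * (2 ^ 12 * 3 ^ 3 * 5 * (Cor22.dmod P : ℝ) * l) < Cor22.logQAvoid P {2, l} →
      ∀ T : Cor22.ThetaVolumeDatumAt P l, Repair.RH.OffSigma.OffSigmaTolerance (1 - 1) (SigmaMass.tol P l) T (ε P l T))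
    (hregC : ∀ P : NFPoint, P ∈ UP → ∀ l : ℕ, l.Prime → 5 ≤ l →
      Cor22.AdmitsCore P → Cor22.CondP2 P l → Cor22.CondP5 P l → Cor22.CondP6 P l →
      6 * ((1 + 20 * (Cor22.dmod P : ℝ) / l) * (P.logDiff + Cor22.logCondAvoid P {2, l}))
          + 120 * (2 ^ 12 * 3 ^ 3 * 5 * (Cor22.dmod P : ℝ) * l) < Cor22.logQAvoid P {2, l} →
      ∀ T : Cor22.ThetaVolumeDatumAt P l,
        (letI := T.instFieldF; letI := T.instNumberFieldF; letI := T.instAlgebraF; letI := T.instFieldK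
         letI := T.instNumberFieldK; letI := T.instAlgebraK; letI := T.instFieldFbar; letI := T.instAlgebraFbar
         letI := T.instAlgebraKFbar; letI := T.instIsElliptic
         ¬ (∀ p ∈ T.I.supportPrimes, ∀ v w : placesOver (fieldOfModuli T.E) p,
            (Summit.ABC.IUTFork.DHData.ofInput T.I).logQloc p v = (Summit.ABC.IUTFork.DHData.ofInput T.I).logQloc p w)) →
        T.HullEstimateOf
          (((l : ℝ) + 1) / 4 *
            ((1 + 12 * (Cor22.dmod P : ℝ) / l) * (P.logDiff + Cor22.logCondAvoid P {2, l})
              + 2 * Real.log l + 52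
              + 20 / 3 * Real.log (((2 ^ 12 * 3 ^ 3 * 5 * Cor22.dmod P : ℕ) : ℝ) * (l : ℝ))
                * (Nat.primeCounting (2 ^ 12 * 3 ^ 3 * 5 * Cor22.dmod P * l) : ℝ)))) :
    _root_.ABC :=
  ABC_of_cor312Slack_content_hregC ε h312C
    (fun P hP l hl h5 hcore hP2 hP5 hP6 hct T => by
      have h := hMuC P hP l hl h5 hcore hP2 hP5 hP6 hct T
      unfold Repair.RH.OffSigma.OffSigmaTolerance SigmaMass.tol at h
      linarith)
    hregC

end Summit.ABC.IUTFork.Conditional.Cor312Slack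

end
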